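import Literature.LinearAlgebra.TensorNetworks.QTTLaplace
import Literature.LinearAlgebra.TensorNetworks.TensorTrainSVD
import Literature.LinearAlgebra.TensorNetworks.QuanticsRankBounds

/-!
# QTT rank bounds for circulant matrices whose symbol spans a finite-dimensional shift space
(Vysotsky–Rakhuba 2022, §3: Theorem 3.1, Corollary 3.1, Corollary 3.2)

Source: L. Vysotsky, M. Rakhuba, *Tensor rank bounds and explicit QTT representations for the
inverses of circulant matrices*, Numer. Linear Algebra Appl. 30(3) (2023) e2461, arXiv:2205.04335
[VysotskyRakhuba2022] (held text: `paper:arxiv-2205.04335`, §3).  The unfolding-rank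
characterisation of TT ranks is [Oseledets2011, Thm. 2.1] (files `QuanticsTensorTrain`,
`TensorTrainSVD`); the QTT matrix format is [KazeevKhoromskij2012, eq. (2)] (file `QTTLaplace`,
`TensorTrain.qttMatrix`).

## The statements (verbatim, arXiv text §3)

"**Theorem 3.1.** Consider a function `f : ℤ → ℂ` and let `f_q(i) ≡ f(i+q)` for every fixed
`q ∈ ℤ`.  Assume that the following linear space of functions is finite-dimensional:
`V ≡ span{f_q | q ∈ ℤ}`.  Consider a circulant `A ∈ ℂ^{(N₁N₂) × (N₁N₂)}` with the elements
`A_{ij} = f((i−j) mod N₁N₂)`, and a following "reshaped" matrix `Â ∈ ℂ^{N₁² × N₂²}`: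
`Â_{i₁N₁ + j₁, i₂N₂ + j₂} = A_{i₁N₂ + i₂, j₁N₂ + j₂}`, `i₁, j₁ ∈ {0, …, N₁−1}`,
`i₂, j₂ ∈ {0, …, N₂−1}`.  Then `rank Â ≤ 1 + dim V`."

"**Corollary 3.1.** If under the conditions of Theorem 3.1 the circulant `A` is of shape
`b^L × b^L` for some positive integer `L`, then it admits a QTT representation with the ranks not
greater than `1 + dim V`."  (Proof, ibid.: "the `k`-th QTT rank of `A`, `k = 1, …, L−1`, is equal
to the rank of unfolding matrix `A_k ∈ ℂ^{b^{2k} × b^{2(L−k)}}` (see [Oseledets2011])",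
`(A_k)_{(j_k i_k … j_1 i_1), (j_L i_L … j_{k+1} i_{k+1})} = A_{(i_L … i_1), (j_L … j_1)}`, and `A_k`
is the matrix `Â_k` of the Theorem with `N₁ = b^k`, `N₂ = b^{L−k}` up to row and column
permutations.)

"**Corollary 3.2.** Let `A ∈ ℂ^{b^L × b^L}` be a circulant with elements `f((i−j) mod b^L)`
where `f(i) = Σ_{k=1}^s P_k(i) z_k^i` for some polynomials `P_1(i), …, P_s(i)` of degrees
`p_1, …, p_s` respectively, and `z_1, …, z_s ∈ ℂ`.  Then QTT ranks of `A` do not exceed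
`s + 1 + p_1 + ⋯ + p_s`."  (Proof, ibid.: the shifts `f_j` are again of this form with the same
degrees, so `{z_1^i, i z_1^i, …, i^{p_1} z_1^i, …, z_s^i, …, i^{p_s} z_s^i}` "contains the basis of
space `V`, so `dim V ≤ (1+p_1) + ⋯ + (1+p_s)`.")

## What is proved here (any field `K` for the rank bounds; the paper has `K = ℂ`)

* The objects: the QTT tensor `qttTensor A` of a `b^R × b^R` matrix on the digit-pair legs
  `Fin b × Fin b` (most significant digit first, `quanticsEquiv`), so that a train `T` represents
  `A` in the sense of `TensorTrain.qttMatrix` iff `T.eval = qttTensor A`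
  (`TensorTrain.qttMatrix_eq_iff_eval_eq_qttTensor`); the `k`-th QTT unfolding matrix
  `qttUnfolding A k m h` (rows = the first `k` digit pairs, columns = the last `m`, `k + m = R`) —
  the paper's `A_k` with rows and columns listed by digit pairs `(i_r, j_r)` instead of the
  interleaved strings, a relabelling — and the lower bound `rank (qttUnfolding A k) ≤ T.r k` for
  EVERY representing train (`rank_qttUnfolding_le_of_qttMatrix_eq`, from
  `TensorTrain.rank_unfolding_le`); the shift space `shiftSpan f = span{f(· + q) | q ∈ ℤ}`.
* THEOREM 3.1 in the generality actually used by its proof (`rank_le_one_add_finrank_of_twoScale`):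
  for ANY matrix whose entry at `(s, t)` is the circulant entry `f((x − y) mod N)` at indices
  `x = I₁(s)·N₂ + I₂(t)`, `y = J₁(s)·N₂ + J₂(t)` with `I₂, J₂ < N₂`, the rank is at most
  `1 + dim V` for every finite-dimensional `V ⊇ {f_q}` — the rows with `I₁(s) ≠ J₁(s)` are
  restrictions `t ↦ g(I₂(t) − J₂(t))` of shifts `g = f_{φ(s)} ∈ V`, the rows with `I₁(s) = J₁(s)`
  are all equal (the paper's `v^{(r+1)}`), so the row space lies in `L(V) + K·v₀`.  The literal
  reshaped matrix `Â` of the Theorem is the instance `rank_reshapeCirculant_le` (rows `(i₁, j₁)`,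
  columns `(i₂, j₂)`) and `rank_reshapeCirculant_le'` (rows `i₁N₁ + j₁`, columns `i₂N₂ + j₂`,
  exactly as displayed); `…_shiftSpan` versions take `V = shiftSpan f`.
* COROLLARY 3.1 (`rank_qttUnfolding_circulant_le`): every QTT unfolding matrix of the `b^L × b^L`
  circulant with symbol `f` has rank `≤ 1 + dim V` (the instance `N = b^L`, `N₂ = b^m`, digit
  strings split by `val_quanticsEquiv_append`: `m(σ ⧺ τ) = m(σ)·b^m + m(τ)`); and, over `ℝ`,
  "admits a QTT representation with the ranks not greater than `1 + dim V`"
  (`exists_qttMatrix_eq_circulant_rank_le`, from the TT-SVD existence theorem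
  `exists_tensorTrain_eval_eq_rank_le` of file `TensorTrainSVD`, packaged for matrices as
  `exists_tensorTrain_qttMatrix_eq`).
* COROLLARY 3.2 (`rank_qttUnfolding_circulant_expPoly_le`, `exists_qttMatrix_eq_circulant_expPoly`):
  for `f(i) = Σ_k P_k(i) z_k^i` with `natDegree P_k ≤ p_k` and `z_k ≠ 0` the QTT unfolding ranks are
  `≤ s + 1 + Σ_k p_k`, via `shift_mem_expPolySpan` (the shifts lie in
  `expPolySpan z p = span{i ↦ i^a z_k^i | a ≤ p_k}`) and `finrank_expPolySpan_le`
  (`dim ≤ Σ_k (p_k + 1)`); `finrank_shiftSpan_le_of_expPoly` is the paper's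
  "`dim V ≤ (1+p_1) + ⋯ + (1+p_s)`"; the pure exponential-sum case `p_k = 0` (ranks `≤ s + 1`,
  cf. the explicit representation of Proposition 4.1, file `QTTCirculantExpSum`) is
  `rank_qttUnfolding_circulant_expSum_le`.  The hypothesis `z_k ≠ 0` is implicit in the paper
  (`z_k^i` for negative `i`); `i ↦ P_k(i)` is evaluated at the image of `i` in `K`.

Not formalised here: Corollary 3.3 (QTT ranks of `A⁻¹` are at most `m + n` for the banded
circulants of Theorem 2.1) — it is Corollary 3.2 applied to the explicit inverse symbol of
Theorem 2.1, whose derivation (partial fractions / residues of the generating rational function) is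
not in the tree; the exact (field-independent) converse of `rank_qttUnfolding_le_of_qttMatrix_eq`
(a train with `T.r k = rank A_k` exists over any field) is only available over `ℝ` (TT-SVD), so the
existence halves of Corollaries 3.1/3.2 are stated over `ℝ` and the rank bounds over any field.

AI-produced formalisation (H21 engines group, seat eng-quad-2, 2026-08-23); statements checked
against the arXiv text; no facts, no axioms beyond Mathlib's, no `sorry`.
-/

open Matrix Finset Polynomial

universe u

namespace Literature.LinearAlgebra.TensorNetworks

/-! ## QTT tensors and QTT unfolding matrices of a `b^R × b^R` matrix -/

section QTTUnfolding

variable {K : Type u} {b R : ℕ}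

/-- THE QTT TENSOR of a `b^R × b^R` matrix `A` on the digit-pair legs `Fin b × Fin b`:
`(qttTensor A)((i₁,j₁), …, (i_R,j_R)) = A(i, j)` with `i, j` encoded most significant digit first
(`quanticsEquiv`) — the tensor a QTT matrix representation interpolates
[KazeevKhoromskij2012, eq. (2)].  [cite: VysotskyRakhuba2022, Cor. 3.1 (proof)] -/
def qttTensor (A : Matrix (Fin (b ^ R)) (Fin (b ^ R)) K) : (Fin R → Fin b × Fin b) → K :=
  fun s => A (quanticsEquiv b R fun r => (s r).1) (quanticsEquiv b R fun r => (s r).2)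

/-- Definitional unfolding of `qttTensor`.  [cite: VysotskyRakhuba2022, Cor. 3.1 (proof)] -/
@[simp] theorem qttTensor_apply (A : Matrix (Fin (b ^ R)) (Fin (b ^ R)) K)
    (s : Fin R → Fin b × Fin b) :
    qttTensor A s = A (quanticsEquiv b R fun r => (s r).1) (quanticsEquiv b R fun r => (s r).2) :=
  rfl

/-- THE `k`-TH QTT UNFOLDING MATRIX `A_k` of a `b^R × b^R` matrix (`k + m = R`): rows indexed by
the first `k` digit pairs `((i₁,j₁), …, (i_k,j_k))`, columns by the last `m`, entry `A(i, j)` — the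
paper's `(A_k)_{(j_k i_k … j_1 i_1), (j_R i_R … j_{k+1} i_{k+1})} = A_{(i_R … i_1), (j_R … j_1)}`
with rows and columns listed by digit pairs (a relabelling, which does not change the rank).
[cite: VysotskyRakhuba2022, Cor. 3.1 (proof)] [cite: Oseledets2011, Thm. 2.1] -/
def qttUnfolding (A : Matrix (Fin (b ^ R)) (Fin (b ^ R)) K) (k m : ℕ) (h : k + m = R) :
    Matrix (Fin k → Fin b × Fin b) (Fin m → Fin b × Fin b) K :=
  Matrix.of fun s t => qttTensor A fun i => Fin.append s t (i.cast h.symm)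

/-- Definitional unfolding of `qttUnfolding`.  [cite: VysotskyRakhuba2022, Cor. 3.1 (proof)] -/
theorem qttUnfolding_apply (A : Matrix (Fin (b ^ R)) (Fin (b ^ R)) K) (k m : ℕ) (h : k + m = R)
    (s : Fin k → Fin b × Fin b) (t : Fin m → Fin b × Fin b) :
    qttUnfolding A k m h s t = qttTensor A (fun i => Fin.append s t (i.cast h.symm)) :=
  rfl

end QTTUnfolding

section QTTRepresentation

variable {K : Type u} [CommSemiring K] {b R : ℕ}

/-- A train on the digit-pair legs represents the matrix `A` (`T.qttMatrix = A`,
[KazeevKhoromskij2012, eq. (2)]) iff its values are the QTT tensor of `A`.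
[cite: VysotskyRakhuba2022, Cor. 3.1 (proof)] -/
theorem TensorTrain.qttMatrix_eq_iff_eval_eq_qttTensor (T : TensorTrain K (Fin b × Fin b) R)
    (A : Matrix (Fin (b ^ R)) (Fin (b ^ R)) K) :
    T.qttMatrix = A ↔ ∀ s, T.eval s = qttTensor A s := by
  rw [TensorTrain.qttMatrix_eq_iff]
  exact ⟨fun h s => h (fun r => (s r).1) (fun r => (s r).2), fun h σ μ => h fun r => (σ r, μ r)⟩

end QTTRepresentation

section QTTUnfoldingRank

variable {K : Type u} [Field K] {b R : ℕ}

/-- "The `k`-th QTT rank of `A` … is equal to the rank of unfolding matrix `A_k`" — the half valid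
for EVERY representation: if a train `T` on the digit-pair legs represents `A`, then
`rank A_k ≤ r_k(T)` (`TensorTrain.rank_unfolding_le`).
[cite: VysotskyRakhuba2022, Cor. 3.1 (proof)] [cite: Oseledets2011, Thm. 2.1] -/
theorem rank_qttUnfolding_le_of_qttMatrix_eq (T : TensorTrain K (Fin b × Fin b) R)
    (A : Matrix (Fin (b ^ R)) (Fin (b ^ R)) K) (hT : T.qttMatrix = A) (k m : ℕ) (h : k + m = R) :
    (qttUnfolding A k m h).rank ≤ T.r k := by
  have hev := (T.qttMatrix_eq_iff_eval_eq_qttTensor A).1 hT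
  have hU : qttUnfolding A k m h = Matrix.of fun (s : Fin k → Fin b × Fin b)
      (t : Fin m → Fin b × Fin b) => T.eval (fun i => Fin.append s t (i.cast h.symm)) := by
    ext s t
    rw [qttUnfolding_apply, Matrix.of_apply, hev]
  rw [hU]
  exact T.rank_unfolding_le k m h

end QTTUnfoldingRank

section RealExistence

variable {b R : ℕ}

/-- Over `ℝ` the QTT unfolding matrix is the unfolding matrix (file `TensorTrainSVD`) of the QTT
tensor, definitionally.  [cite: VysotskyRakhuba2022, Cor. 3.1 (proof)] -/
theorem qttUnfolding_eq_unfolding (A : Matrix (Fin (b ^ R)) (Fin (b ^ R)) ℝ) (k m : ℕ)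
    (h : k + m = R) : qttUnfolding A k m h = unfolding (qttTensor A) k m h :=
  rfl

/-- EXISTENCE OF A QTT REPRESENTATION WITH THE UNFOLDING RANKS (over `ℝ`, by TT-SVD,
`exists_tensorTrain_eval_eq_rank_le`): every `b^R × b^R` real matrix is represented exactly by a
train on the digit-pair legs whose `k`-th bond dimension is at most `rank A_k` (`0 < k < R`;
boundary bond dimensions `1`).  Together with `rank_qttUnfolding_le_of_qttMatrix_eq` this is "the
`k`-th QTT rank of `A` is equal to the rank of unfolding matrix `A_k`".
[cite: VysotskyRakhuba2022, Cor. 3.1 (proof)] [cite: Oseledets2011, Thm. 2.1] -/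
theorem exists_tensorTrain_qttMatrix_eq (A : Matrix (Fin (b ^ R)) (Fin (b ^ R)) ℝ) :
    ∃ T : TensorTrain ℝ (Fin b × Fin b) R, T.qttMatrix = A ∧ T.r 0 = 1 ∧ (0 < R → T.r R = 1) ∧
      ∀ k m (h : k + m = R), 0 < k → 0 < m → T.r k ≤ (qttUnfolding A k m h).rank := by
  obtain ⟨T, hT, h0, hR, hr⟩ := exists_tensorTrain_eval_eq_rank_le (qttTensor A)
  exact ⟨T, (T.qttMatrix_eq_iff_eval_eq_qttTensor A).2 hT, h0, hR, hr⟩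

end RealExistence

/-! ## Theorem 3.1: circulants whose symbol spans a finite-dimensional shift space -/

section Circulant

variable {K : Type u} [Field K]

/-- THE SHIFT SPACE `V ≡ span{f_q | q ∈ ℤ}`, `f_q(i) ≡ f(i + q)`, of a function `f : ℤ → K`.
[cite: VysotskyRakhuba2022, Thm. 3.1] -/
def shiftSpan (f : ℤ → K) : Submodule K (ℤ → K) :=
  Submodule.span K (Set.range fun q : ℤ => fun i : ℤ => f (i + q))

/-- Every shift `f_q` lies in the shift space.  [cite: VysotskyRakhuba2022, Thm. 3.1] -/
theorem shift_mem_shiftSpan (f : ℤ → K) (q : ℤ) : (fun i => f (i + q)) ∈ shiftSpan f :=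
  Submodule.subset_span ⟨q, rfl⟩

/-- `f = f_0` lies in its shift space.  [cite: VysotskyRakhuba2022, Thm. 3.1] -/
theorem self_mem_shiftSpan (f : ℤ → K) : f ∈ shiftSpan f := by
  simpa using shift_mem_shiftSpan f 0

/-- The shift space is the least subspace containing all shifts.
[cite: VysotskyRakhuba2022, Thm. 3.1] -/
theorem shiftSpan_le_iff (f : ℤ → K) (V : Submodule K (ℤ → K)) :
    shiftSpan f ≤ V ↔ ∀ q : ℤ, (fun i => f (i + q)) ∈ V := by
  rw [shiftSpan, Submodule.span_le, Set.range_subset_iff]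
  rfl

/-- THEOREM 3.1, AS PROVED (two-scale form).  Let every shift `f_q` of `f : ℤ → K` lie in a
finite-dimensional subspace `V`.  Let `M` be any matrix whose entry at `(s, t)` is the entry
`f((x − y) mod N)` of the `N × N` circulant with symbol `f` at a row index `x = I₁(s)·N₂ + I₂(t)`
and a column index `y = J₁(s)·N₂ + J₂(t)` with `I₂(t), J₂(t) < N₂`.  Then `rank M ≤ 1 + dim V`: with
`Δ₁ = I₁(s) − J₁(s)`, `Δ₂ = I₂(t) − J₂(t)`, a row with `Δ₁ ≠ 0` is `t ↦ f(Δ₂(t) + φ(s))` for an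
integer `φ(s)` (`= Δ₁N₂`, resp. `Δ₁N₂ + N`), i.e. the restriction `g ↦ (t ↦ g(Δ₂ t))` of the shift
`f_{φ(s)} ∈ V`, and the rows with `Δ₁ = 0` "are all equal to each other and to the vector
`v^{(r+1)}`", so the row space lies in `L(V) + K·v^{(r+1)}`.
[cite: VysotskyRakhuba2022, Thm. 3.1 (proof)] -/
theorem rank_le_one_add_finrank_of_twoScale {ρ τ : Type*} [Fintype ρ] [Fintype τ]
    (f : ℤ → K) (V : Submodule K (ℤ → K)) [FiniteDimensional K V]
    (hV : ∀ q : ℤ, (fun i => f (i + q)) ∈ V) {N N₂ : ℕ} (I₁ J₁ : ρ → ℕ) (I₂ J₂ : τ → ℕ)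
    (hI₂ : ∀ t, I₂ t < N₂) (hJ₂ : ∀ t, J₂ t < N₂) (x y : ρ → τ → Fin N)
    (hx : ∀ s t, (x s t : ℕ) = I₁ s * N₂ + I₂ t) (hy : ∀ s t, (y s t : ℕ) = J₁ s * N₂ + J₂ t)
    (M : Matrix ρ τ K)
    (hM : ∀ s t, M s t = Matrix.circulant (fun j : Fin N => f j) (x s t) (y s t)) :
    M.rank ≤ 1 + Module.finrank K V := by
  classical
  -- entry formula: `M s t = f(Δ₂ t + φ s)` off the block diagonal, `= v₀ t` on it
  have key : ∀ s t, M s t = f (if I₁ s = J₁ s then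
        (if J₂ t ≤ I₂ t then (I₂ t : ℤ) - J₂ t else (I₂ t : ℤ) - J₂ t + N)
      else (I₂ t : ℤ) - J₂ t +
        (if I₁ s < J₁ s then ((I₁ s * N₂ : ℕ) : ℤ) - ((J₁ s * N₂ : ℕ) : ℤ) + N
          else ((I₁ s * N₂ : ℕ) : ℤ) - ((J₁ s * N₂ : ℕ) : ℤ))) := by
    intro s t
    simp only [hM, Matrix.circulant_apply, Fin.coe_int_sub_eq_ite]
    have h1 : I₁ s < J₁ s → I₁ s * N₂ + N₂ ≤ J₁ s * N₂ := fun h => by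
      simpa [add_mul] using Nat.mul_le_mul_right N₂ h
    have h2 : J₁ s < I₁ s → J₁ s * N₂ + N₂ ≤ I₁ s * N₂ := fun h => by
      simpa [add_mul] using Nat.mul_le_mul_right N₂ h
    have h0 : I₁ s = J₁ s → I₁ s * N₂ = J₁ s * N₂ := fun h => by rw [h]
    have h3 := hI₂ t
    have h4 := hJ₂ t
    have hxv := hx s t
    have hyv := hy s t
    congr 1
    revert h0 h1 h2 hxv hyv
    generalize I₁ s * N₂ = a
    generalize J₁ s * N₂ = c
    intro h0 h1 h2 hxv hyv
    split_ifs with hle h5 h6 h7 h8 <;> simp only [Fin.le_iff_val_le_val] at hle <;> omega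
  -- the restriction map `g ↦ (t ↦ g (Δ₂ t))` and the common block-diagonal row `v₀`
  let L : (ℤ → K) →ₗ[K] (τ → K) := LinearMap.funLeft K K fun t => (I₂ t : ℤ) - J₂ t
  let v₀ : τ → K := fun t => f (if J₂ t ≤ I₂ t then (I₂ t : ℤ) - J₂ t else (I₂ t : ℤ) - J₂ t + N)
  have hrow : ∀ s, M s ∈ V.map L ⊔ K ∙ v₀ := by
    intro s
    by_cases hd : I₁ s = J₁ s
    · have hMs : M s = v₀ := funext fun t => by rw [key, if_pos hd]
      rw [hMs]
      exact Submodule.mem_sup_right (Submodule.mem_span_singleton_self v₀)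
    · have hMs : M s = L (fun i => f (i +
          (if I₁ s < J₁ s then ((I₁ s * N₂ : ℕ) : ℤ) - ((J₁ s * N₂ : ℕ) : ℤ) + N
            else ((I₁ s * N₂ : ℕ) : ℤ) - ((J₁ s * N₂ : ℕ) : ℤ)))) := by
        funext t
        rw [key, if_neg hd]
        rfl
      rw [hMs]
      exact Submodule.mem_sup_left (Submodule.mem_map_of_mem (hV _))
  calc M.rank ≤ Module.finrank K ↥(V.map L ⊔ K ∙ v₀) := rank_le_finrank_of_forall_row_mem M _ hrow
    _ ≤ Module.finrank K ↥(V.map L) + Module.finrank K ↥(K ∙ v₀) :=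
        Submodule.finrank_add_le_finrank_add_finrank _ _
    _ ≤ Module.finrank K V + 1 :=
        add_le_add (Submodule.finrank_map_le L V) (finrank_span_le_card ({v₀} : Set (τ → K)))
    _ = 1 + Module.finrank K V := add_comm _ _

/-- THEOREM 3.1 (the reshaped matrix, rows `(i₁, j₁)`, columns `(i₂, j₂)`): for the
`N₁N₂ × N₁N₂` circulant `A_{ij} = f((i−j) mod N₁N₂)` and
`Â_{(i₁,j₁),(i₂,j₂)} = A_{i₁N₂+i₂, j₁N₂+j₂}`, `rank Â ≤ 1 + dim V` for every finite-dimensional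
`V` containing all shifts `f_q`.  [cite: VysotskyRakhuba2022, Thm. 3.1] -/
theorem rank_reshapeCirculant_le (f : ℤ → K) (V : Submodule K (ℤ → K)) [FiniteDimensional K V]
    (hV : ∀ q : ℤ, (fun i => f (i + q)) ∈ V) (N₁ N₂ : ℕ) :
    (Matrix.of fun (p : Fin N₁ × Fin N₁) (q : Fin N₂ × Fin N₂) =>
        Matrix.circulant (fun j : Fin (N₁ * N₂) => f j)
          (finProdFinEquiv (p.1, q.1)) (finProdFinEquiv (p.2, q.2))).rank ≤
      1 + Module.finrank K V :=
  rank_le_one_add_finrank_of_twoScale f V hV (fun p => p.1) (fun p => p.2) (fun q => q.1)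
    (fun q => q.2) (fun q => q.1.isLt) (fun q => q.2.isLt)
    (fun p q => finProdFinEquiv (p.1, q.1)) (fun p q => finProdFinEquiv (p.2, q.2))
    (fun p q => by rw [finProdFinEquiv_apply_val]; ring)
    (fun p q => by rw [finProdFinEquiv_apply_val]; ring) _ fun _ _ => rfl

/-- THEOREM 3.1 (the reshaped matrix exactly as displayed, rows `i₁N₁ + j₁ ∈ {0, …, N₁²−1}`,
columns `i₂N₂ + j₂ ∈ {0, …, N₂²−1}`): `rank Â ≤ 1 + dim V`.
[cite: VysotskyRakhuba2022, Thm. 3.1] -/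
theorem rank_reshapeCirculant_le' (f : ℤ → K) (V : Submodule K (ℤ → K)) [FiniteDimensional K V]
    (hV : ∀ q : ℤ, (fun i => f (i + q)) ∈ V) (N₁ N₂ : ℕ) :
    (Matrix.of fun (u : Fin (N₁ * N₁)) (v : Fin (N₂ * N₂)) =>
        Matrix.circulant (fun j : Fin (N₁ * N₂) => f j)
          (finProdFinEquiv ((finProdFinEquiv.symm u).1, (finProdFinEquiv.symm v).1))
          (finProdFinEquiv ((finProdFinEquiv.symm u).2, (finProdFinEquiv.symm v).2))).rank ≤
      1 + Module.finrank K V :=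
  rank_le_one_add_finrank_of_twoScale f V hV (fun u => (finProdFinEquiv.symm u).1)
    (fun u => (finProdFinEquiv.symm u).2) (fun v => (finProdFinEquiv.symm v).1)
    (fun v => (finProdFinEquiv.symm v).2) (fun v => (finProdFinEquiv.symm v).1.isLt)
    (fun v => (finProdFinEquiv.symm v).2.isLt)
    (fun u v => finProdFinEquiv ((finProdFinEquiv.symm u).1, (finProdFinEquiv.symm v).1))
    (fun u v => finProdFinEquiv ((finProdFinEquiv.symm u).2, (finProdFinEquiv.symm v).2))
    (fun u v => by rw [finProdFinEquiv_apply_val]; ring)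
    (fun u v => by rw [finProdFinEquiv_apply_val]; ring) _ fun _ _ => rfl

/-- THEOREM 3.1 with `V` the shift space itself: `rank Â ≤ 1 + dim span{f_q | q ∈ ℤ}` whenever that
span is finite-dimensional.  [cite: VysotskyRakhuba2022, Thm. 3.1] -/
theorem rank_reshapeCirculant_le_shiftSpan (f : ℤ → K) [FiniteDimensional K (shiftSpan f)]
    (N₁ N₂ : ℕ) :
    (Matrix.of fun (p : Fin N₁ × Fin N₁) (q : Fin N₂ × Fin N₂) =>
        Matrix.circulant (fun j : Fin (N₁ * N₂) => f j)
          (finProdFinEquiv (p.1, q.1)) (finProdFinEquiv (p.2, q.2))).rank ≤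
      1 + Module.finrank K (shiftSpan f) :=
  rank_reshapeCirculant_le f (shiftSpan f) (shift_mem_shiftSpan f) N₁ N₂

/-! ## Corollary 3.1: QTT unfolding ranks of a `b^L × b^L` circulant -/

/-- SPLITTING A DIGIT STRING ("denote `N₁ ≡ b^k`, `N₂ ≡ b^{L−k}`"): the index encoded by the
concatenation `σ ⧺ τ` of `k` leading and `m` trailing digits (most significant first) is
`m(σ)·b^m + m(τ)`.  [cite: VysotskyRakhuba2022, Cor. 3.1 (proof)] -/
theorem val_quanticsEquiv_append {b k m : ℕ} (σ : Fin k → Fin b) (τ : Fin m → Fin b) :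
    ((quanticsEquiv b (k + m) (Fin.append σ τ) : Fin (b ^ (k + m))) : ℕ) =
      (quanticsEquiv b k σ : ℕ) * b ^ m + (quanticsEquiv b m τ : ℕ) := by
  rw [val_quanticsEquiv, val_quanticsEquiv, val_quanticsEquiv, Fin.sum_univ_add, Finset.sum_mul]
  congr 1
  · refine Finset.sum_congr rfl fun i _ => ?_
    have hi := i.isLt
    rw [Fin.append_left, Fin.val_castAdd, show k + m - (i + 1) = k - (i + 1) + m by omega,
      pow_add, mul_assoc]
  · refine Finset.sum_congr rfl fun j _ => ?_
    have hj := j.isLt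
    rw [Fin.append_right, Fin.val_natAdd, show k + m - (k + j + 1) = m - (j + 1) by omega]

/-- [folklore] The first components of an appended string of pairs. -/
private theorem fst_append {α β : Type*} {k m : ℕ} (s : Fin k → α × β) (t : Fin m → α × β)
    (r : Fin (k + m)) : (Fin.append s t r).1 = Fin.append (fun i => (s i).1) (fun j => (t j).1) r :=
  Fin.addCases (fun i => by simp) (fun j => by simp) r

/-- [folklore] The second components of an appended string of pairs. -/
private theorem snd_append {α β : Type*} {k m : ℕ} (s : Fin k → α × β) (t : Fin m → α × β)
    (r : Fin (k + m)) : (Fin.append s t r).2 = Fin.append (fun i => (s i).2) (fun j => (t j).2) r :=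
  Fin.addCases (fun i => by simp) (fun j => by simp) r

/-- COROLLARY 3.1 (rank form, any field): every QTT unfolding matrix `A_k` (`k + m = L`) of the
`b^L × b^L` circulant `A_{ij} = f((i−j) mod b^L)` has `rank A_k ≤ 1 + dim V` for every
finite-dimensional `V` containing the shifts `f_q` — Theorem 3.1 with `N₁ = b^k`, `N₂ = b^m`
(`A_k = P₁ Â_k P₂`).  [cite: VysotskyRakhuba2022, Cor. 3.1] -/
theorem rank_qttUnfolding_circulant_le (f : ℤ → K) (V : Submodule K (ℤ → K))
    [FiniteDimensional K V] (hV : ∀ q : ℤ, (fun i => f (i + q)) ∈ V) (b : ℕ) {L : ℕ} (k m : ℕ)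
    (h : k + m = L) :
    (qttUnfolding (Matrix.circulant fun j : Fin (b ^ L) => f j) k m h).rank ≤
      1 + Module.finrank K V := by
  subst h
  have hM : ∀ (s : Fin k → Fin b × Fin b) (t : Fin m → Fin b × Fin b),
      qttUnfolding (Matrix.circulant fun j : Fin (b ^ (k + m)) => f j) k m rfl s t =
        Matrix.circulant (fun j : Fin (b ^ (k + m)) => f j)
          (quanticsEquiv b (k + m) (Fin.append (fun i => (s i).1) fun j => (t j).1))
          (quanticsEquiv b (k + m) (Fin.append (fun i => (s i).2) fun j => (t j).2)) := by
    intro s t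
    rw [qttUnfolding_apply, qttTensor_apply]
    simp only [Fin.cast_eq_self, fst_append, snd_append]
  have hx : ∀ (s : Fin k → Fin b × Fin b) (t : Fin m → Fin b × Fin b),
      ((quanticsEquiv b (k + m) (Fin.append (fun i => (s i).1) fun j => (t j).1) :
        Fin (b ^ (k + m))) : ℕ) = (quanticsEquiv b k fun i => (s i).1 : ℕ) * b ^ m +
          (quanticsEquiv b m fun j => (t j).1 : ℕ) := fun s t => val_quanticsEquiv_append _ _
  have hy : ∀ (s : Fin k → Fin b × Fin b) (t : Fin m → Fin b × Fin b),
      ((quanticsEquiv b (k + m) (Fin.append (fun i => (s i).2) fun j => (t j).2) :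
        Fin (b ^ (k + m))) : ℕ) = (quanticsEquiv b k fun i => (s i).2 : ℕ) * b ^ m +
          (quanticsEquiv b m fun j => (t j).2 : ℕ) := fun s t => val_quanticsEquiv_append _ _
  -- the index maps `I₁, J₁, I₂, J₂, x, y` are determined by `hx`, `hy` (first-order unification)
  exact rank_le_one_add_finrank_of_twoScale f V hV (N := b ^ (k + m)) (N₂ := b ^ m) _ _ _ _
    (fun t => Fin.isLt _) (fun t => Fin.isLt _) _ _ hx hy _ hM

/-- COROLLARY 3.1 with `V` the shift space itself.  [cite: VysotskyRakhuba2022, Cor. 3.1] -/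
theorem rank_qttUnfolding_circulant_le_shiftSpan (f : ℤ → K) [FiniteDimensional K (shiftSpan f)]
    (b : ℕ) {L : ℕ} (k m : ℕ) (h : k + m = L) :
    (qttUnfolding (Matrix.circulant fun j : Fin (b ^ L) => f j) k m h).rank ≤
      1 + Module.finrank K (shiftSpan f) :=
  rank_qttUnfolding_circulant_le f (shiftSpan f) (shift_mem_shiftSpan f) b k m h

end Circulant

section CirculantReal

/-- COROLLARY 3.1 (representation form, over `ℝ`): under the conditions of Theorem 3.1 a
`b^L × b^L` circulant "admits a QTT representation with the ranks not greater than `1 + dim V`"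
(boundary ranks `1`).  [cite: VysotskyRakhuba2022, Cor. 3.1] -/
theorem exists_qttMatrix_eq_circulant_rank_le (f : ℤ → ℝ) (V : Submodule ℝ (ℤ → ℝ))
    [FiniteDimensional ℝ V] (hV : ∀ q : ℤ, (fun i => f (i + q)) ∈ V) (b L : ℕ) :
    ∃ T : TensorTrain ℝ (Fin b × Fin b) L,
      T.qttMatrix = Matrix.circulant (fun j : Fin (b ^ L) => f j) ∧ T.r 0 = 1 ∧
        (0 < L → T.r L = 1) ∧ ∀ k, 0 < k → k < L → T.r k ≤ 1 + Module.finrank ℝ V := by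
  obtain ⟨T, hT, h0, hL, hr⟩ :=
    exists_tensorTrain_qttMatrix_eq (Matrix.circulant fun j : Fin (b ^ L) => f j)
  exact ⟨T, hT, h0, hL, fun k hk hkL => (hr k (L - k) (by omega) hk (by omega)).trans
    (rank_qttUnfolding_circulant_le f V hV b k (L - k) _)⟩

end CirculantReal

/-! ## Corollary 3.2: exponential-polynomial symbols -/

section ExpPoly

variable {K : Type u} [Field K] {s : ℕ}

/-- THE SPACE `span{z_1^i, i z_1^i, …, i^{p_1} z_1^i, …, z_s^i, …, i^{p_s} z_s^i}` of functions
`ℤ → K` (monomial-exponentials `i ↦ i^a z_k^i`, `a ≤ p_k`).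
[cite: VysotskyRakhuba2022, Cor. 3.2] -/
def expPolySpan (z : Fin s → K) (p : Fin s → ℕ) : Submodule K (ℤ → K) :=
  Submodule.span K (Set.range fun e : (Σ k : Fin s, Fin (p k + 1)) =>
    fun i : ℤ => (i : K) ^ (e.2 : ℕ) * z e.1 ^ i)

/-- The monomial-exponential space is finite-dimensional.  [cite: VysotskyRakhuba2022, Cor. 3.2] -/
instance finiteDimensional_expPolySpan (z : Fin s → K) (p : Fin s → ℕ) :
    FiniteDimensional K (expPolySpan z p) :=
  Module.Finite.span_of_finite K (Set.finite_range _)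

/-- "`dim V ≤ (1+p_1) + ⋯ + (1+p_s)`": the monomial-exponential space has dimension at most
`s + Σ_k p_k` (it is spanned by that many functions).  [cite: VysotskyRakhuba2022, Cor. 3.2] -/
theorem finrank_expPolySpan_le (z : Fin s → K) (p : Fin s → ℕ) :
    Module.finrank K (expPolySpan z p) ≤ s + ∑ k, p k := by
  refine (finrank_range_le_card (R := K) fun e : (Σ k : Fin s, Fin (p k + 1)) =>
    fun i : ℤ => (i : K) ^ (e.2 : ℕ) * z e.1 ^ i).trans (le_of_eq ?_)
  rw [Fintype.card_sigma]
  simp only [Fintype.card_fin, Finset.sum_add_distrib, Finset.sum_const, Finset.card_univ,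
    smul_eq_mul, mul_one]
  exact add_comm _ _

/-- THE SHIFT-INVARIANCE STEP of Corollary 3.2: if `f(i) = Σ_k P_k(i) z_k^i` with
`deg P_k ≤ p_k` and `z_k ≠ 0`, then every shift `f_j(i) = f(i+j) = Σ_k P_k(i+j) z_k^{i+j}
= Σ_k P_{k,j}(i) z_k^i` "for some polynomials `P_{k,j}` of degrees `p_1, …, p_s`", hence lies in the
monomial-exponential space.  [cite: VysotskyRakhuba2022, Cor. 3.2 (proof)] -/
theorem shift_mem_expPolySpan (z : Fin s → K) (hz : ∀ k, z k ≠ 0) (p : Fin s → ℕ)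
    (P : Fin s → K[X]) (hP : ∀ k, (P k).natDegree ≤ p k) (f : ℤ → K)
    (hf : ∀ i, f i = ∑ k, (P k).eval (i : K) * z k ^ i) (q : ℤ) :
    (fun i => f (i + q)) ∈ expPolySpan z p := by
  have hdeg : ∀ k, ((P k).comp (X + C (q : K))).natDegree < p k + 1 := fun k =>
    lt_of_le_of_lt (natDegree_comp_le.trans (by rw [natDegree_X_add_C, mul_one]; exact hP k))
      (Nat.lt_succ_self _)
  have hcomp : ∀ k (i : ℤ), (P k).eval ((i : K) + (q : K)) =
      ((P k).comp (X + C (q : K))).eval (i : K) := fun k i => by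
    rw [eval_comp, eval_add, eval_X, eval_C]
  have hfun : (fun i => f (i + q)) = ∑ k : Fin s, ∑ a : Fin (p k + 1),
      (((P k).comp (X + C (q : K))).coeff a * z k ^ q) •
        (fun i : ℤ => (i : K) ^ (a : ℕ) * z k ^ i) := by
    funext i
    simp only [Finset.sum_apply, Pi.smul_apply, smul_eq_mul]
    rw [hf]
    push_cast
    refine Finset.sum_congr rfl fun k _ => ?_
    rw [zpow_add₀ (hz k), hcomp k i, eval_eq_sum_range' (hdeg k), Finset.sum_range,
      Finset.sum_mul]
    exact Finset.sum_congr rfl fun a _ => by ring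
  rw [hfun]
  exact Submodule.sum_mem _ fun k _ => Submodule.sum_mem _ fun a _ =>
    Submodule.smul_mem _ _ (Submodule.subset_span ⟨⟨k, a⟩, rfl⟩)

/-- Corollary 3.2, the dimension count: for `f(i) = Σ_k P_k(i) z_k^i` (`deg P_k ≤ p_k`, `z_k ≠ 0`)
the shift space `V = span{f_q}` is finite-dimensional of dimension at most
`(1+p_1) + ⋯ + (1+p_s) = s + Σ_k p_k`.  [cite: VysotskyRakhuba2022, Cor. 3.2 (proof)] -/
theorem finrank_shiftSpan_le_of_expPoly (z : Fin s → K) (hz : ∀ k, z k ≠ 0) (p : Fin s → ℕ)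
    (P : Fin s → K[X]) (hP : ∀ k, (P k).natDegree ≤ p k) (f : ℤ → K)
    (hf : ∀ i, f i = ∑ k, (P k).eval (i : K) * z k ^ i) :
    Module.finrank K (shiftSpan f) ≤ s + ∑ k, p k :=
  (Submodule.finrank_mono ((shiftSpan_le_iff f _).2 (shift_mem_expPolySpan z hz p P hP f hf))).trans
    (finrank_expPolySpan_le z p)

/-- COROLLARY 3.2 (rank form, any field): if `f(i) = Σ_{k=1}^s P_k(i) z_k^i` with `deg P_k ≤ p_k`
and `z_k ≠ 0`, every QTT unfolding matrix of the `b^L × b^L` circulant `A_{ij} = f((i−j) mod b^L)`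
has rank at most `s + 1 + p_1 + ⋯ + p_s`.  [cite: VysotskyRakhuba2022, Cor. 3.2] -/
theorem rank_qttUnfolding_circulant_expPoly_le (z : Fin s → K) (hz : ∀ k, z k ≠ 0)
    (p : Fin s → ℕ) (P : Fin s → K[X]) (hP : ∀ k, (P k).natDegree ≤ p k) (f : ℤ → K)
    (hf : ∀ i, f i = ∑ k, (P k).eval (i : K) * z k ^ i) (b : ℕ) {L : ℕ} (l m : ℕ)
    (h : l + m = L) :
    (qttUnfolding (Matrix.circulant fun j : Fin (b ^ L) => f j) l m h).rank ≤
      s + 1 + ∑ k, p k := by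
  have h1 := rank_qttUnfolding_circulant_le f (expPolySpan z p)
    (shift_mem_expPolySpan z hz p P hP f hf) b l m h
  have h2 := finrank_expPolySpan_le z p
  omega

/-- COROLLARY 3.2, the pure exponential-sum case (`p_k = 0`, `f(i) = Σ_k c_k z_k^i`): QTT unfolding
ranks at most `s + 1` (compare the explicit rank-`(2, s+1, …, s+1)` representation of
Proposition 4.1, file `QTTCirculantExpSum`).  [cite: VysotskyRakhuba2022, Cor. 3.2] -/
theorem rank_qttUnfolding_circulant_expSum_le (z : Fin s → K) (hz : ∀ k, z k ≠ 0) (c : Fin s → K)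
    (f : ℤ → K) (hf : ∀ i, f i = ∑ k, c k * z k ^ i) (b : ℕ) {L : ℕ} (l m : ℕ) (h : l + m = L) :
    (qttUnfolding (Matrix.circulant fun j : Fin (b ^ L) => f j) l m h).rank ≤ s + 1 := by
  simpa using rank_qttUnfolding_circulant_expPoly_le z hz (fun _ => 0) (fun k => C (c k))
    (fun k => by simp) f (fun i => by simpa using hf i) b l m h

end ExpPoly

section ExpPolyReal

variable {s : ℕ}

/-- COROLLARY 3.2 (representation form, over `ℝ`): the circulant with symbol
`f(i) = Σ_k P_k(i) z_k^i` (`deg P_k ≤ p_k`, `z_k ≠ 0`) admits a QTT representation with all ranks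
at most `s + 1 + Σ_k p_k`.  [cite: VysotskyRakhuba2022, Cor. 3.2] -/
theorem exists_qttMatrix_eq_circulant_expPoly (z : Fin s → ℝ) (hz : ∀ k, z k ≠ 0)
    (p : Fin s → ℕ) (P : Fin s → ℝ[X]) (hP : ∀ k, (P k).natDegree ≤ p k) (f : ℤ → ℝ)
    (hf : ∀ i, f i = ∑ k, (P k).eval (i : ℝ) * z k ^ i) (b L : ℕ) :
    ∃ T : TensorTrain ℝ (Fin b × Fin b) L,
      T.qttMatrix = Matrix.circulant (fun j : Fin (b ^ L) => f j) ∧ T.r 0 = 1 ∧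
        (0 < L → T.r L = 1) ∧ ∀ k, 0 < k → k < L → T.r k ≤ s + 1 + ∑ k, p k := by
  obtain ⟨T, hT, h0, hL, hr⟩ := exists_qttMatrix_eq_circulant_rank_le f (expPolySpan z p)
    (shift_mem_expPolySpan z hz p P hP f hf) b L
  have h2 := finrank_expPolySpan_le z p
  exact ⟨T, hT, h0, hL, fun k hk hkL => (hr k hk hkL).trans (by omega)⟩

end ExpPolyReal

end Literature.LinearAlgebra.TensorNetworks
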